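import Mathlib
import Literature.NumberTheory.MahlerMeasure.AbelianHeightBound
import Summits.Ventures.DiscreteObjects.Mahler.CyclotomicFieldIntegersLehmer

/-!
# Discharge of the Literature named fact `CyclotomicIntegerHeightBound` (venture `DiscreteObjects`, target L)

Cell `pub-namedobj`, seat `pub-namedobj-mahler-g28`. Framing: lottery ticket; floor = certified bounds/negative ranges.

`Literature.NumberTheory.MahlerMeasure.CyclotomicIntegerHeightBound` — [cite: BombieriGubler2001, Theorem 4.4.9]
(Amoroso–Dvornicich 2000), `h(α) ≥ log(5/2)/10`, recorded for the algebraic integers of the cyclotomic fields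
`ℚ(ζ_m) ⊂ ℂ` as `(5/2)^{deg α} ≤ M(minpoly_ℤ α)^{10}` — HOLDS in the kernel (`cyclotomicIntegerHeightBound_holds`), by
`CyclotomicFieldIntegersLehmer.lehmer_of_isIntegral_mem_cyclotomicField` (the printed proof with `p = 5`:
`CyclotomicIntegerLehmerAll`).  No new mathematics.
-/

namespace Summit.Ventures.DiscreteObjects.Mahler

open Polynomial

/-- **[BombieriGubler2001, Theorem 4.4.9] holds for the algebraic integers of every cyclotomic field**, discharging
the Literature named fact `CyclotomicIntegerHeightBound`. -/
theorem cyclotomicIntegerHeightBound_holds : Literature.NumberTheory.MahlerMeasure.CyclotomicIntegerHeightBound := by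
  intro m hm ζ hζ α hα hint h0 hnu
  have h := (lehmer_of_isIntegral_mem_cyclotomicField hm hζ hα hint h0 hnu).1
  unfold intMahlerMeasure at h
  exact h

end Summit.Ventures.DiscreteObjects.Mahler
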